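import Mathlib
import Literature.Probability.Percolation.Crossings
import Literature.Probability.Percolation.SiteConnectionTools
import Literature.Probability.Percolation.BondPercolationSymmetry
import Literature.Probability.Percolation.LatticeSymmetry
import Literature.Probability.Percolation.InequalitiesProofs
import Literature.Probability.Percolation.MinOpenCut
import Literature.Probability.Percolation.SupercriticalClusterTransienceCorners
import Summits.CriticalPhenomena.PercolationContinuityZ3.Theorems.PinholeClosing.Negative.PinholeClosingBaseline
import HarnessLib

/-!
# Crux `PercBudgetLadder.PinholeClosing` (stmt-CriticalPhenomena-5249), line `halfspace-polarisation` — stub `stub_pinholeBehindPlane`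

Helper file for the crux skeleton `Cruxes/PinholeClosing/Lines/halfspace_polarisation.lean`
(lead prover-line-stmt-CriticalPhenomena-5249-0); proves exactly the registered stub `stub_pinholeBehindPlane`
(`--supports stmt-CriticalPhenomena-5249`).  No new definitions: statements are in the tree's vocabulary
(`bondPercolation (zdGraph 3) (criticalProbI 3)`, `box`, `innerBoundary`, `openConnIn`).

**Statement ("a single pinhole lies behind a coordinate plane").**  For critical bond percolation on `ℤ³`,
the probability that the annulus `box 3 n → ∂ⁱⁿ box 3 L` can be blocked inside `box 3 L` by closing at
most ONE edge is at most the sum, over the six signed coordinate axes `(i, σ)`, `σ = ±1`, of the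
probability that the closed half-box `{v ∈ box 3 L | σ v_i ≥ 0}` carries no open path from `box 3 n` to
`∂ⁱⁿ box 3 L`.

**Proof.**  The measure is carried by lattice configurations (`real_mono_of_lattice`), so it suffices to
show the pointwise inclusion of the blocked event into the union of the six half-box events on lattice
configurations, and to finish with the outer-measure union bound `measureReal_biUnion_finset_le`.  For a
lattice configuration the blocking set may be taken among the lattice edges inside the box
(`exists_cutset_subset_edgesIn`).  If it is empty there is no open crossing at all, a fortiori none in a
half-box.  If it is a single lattice edge `s(u, w)`, then `u, w` differ by a unit coordinate vector `eᵢ`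
(`zdGraph_adj_iff`), so one endpoint `v` has `v_i ≠ 0`; with `σ := -sign v_i` we get `σ v_i ≤ -1`, i.e. the
edge has an endpoint strictly behind the plane `{v_i = 0}`.  A path confined to the front half-box
`{σ v_i ≥ 0}` never traverses such an edge, hence is open in `ω \ S` as well and runs inside `box 3 L`
(graph homomorphism between the induced open graphs, `StubPinholeBehindPlane.front_blocked_of_polar`) —
contradicting the blocking.
-/

noncomputable section

namespace Summit.CriticalPhenomena.PercolationContinuityZ3.Theorems

open MeasureTheory Filter
open Literature.Probability.Percolation Literature.Probability.LatticeModels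
open Summit.CriticalPhenomena.PercolationContinuityZ3.Theorems.PinholeClosing.Negative

namespace StubPinholeBehindPlane

/-- **Back kills front** (every configuration): if every edge of the closed set `S` has an endpoint
strictly behind the plane `{v_i = 0}` (`σ v_i ≤ -1`) and closing `S` blocks the annulus
`box 3 n → ∂ⁱⁿ box 3 L` inside `box 3 L`, then there is no open path from `box 3 n` to `∂ⁱⁿ box 3 L`
confined to the front half-box `{v ∈ box 3 L | σ v_i ≥ 0}`: such a path uses no edge of `S`, so it is an
`(ω \ S)`-open crossing inside `box 3 L`. -/
theorem front_blocked_of_polar {n L : ℕ} {ω : BondConfig (Site 3)} {i : Fin 3} {σ : ℤ}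
    {S : Finset (Sym2 (Site 3))} (hpol : ∀ e ∈ S, ∃ v ∈ e, σ * v i ≤ -1)
    (hb : ¬ ∃ x ∈ box 3 n, ∃ y ∈ innerBoundary (zdGraph 3) (box 3 L),
      (ω \ ↑S) ∈ openConnIn ↑(box 3 L) x y) :
    ¬ ∃ x ∈ box 3 n, ∃ y ∈ innerBoundary (zdGraph 3) (box 3 L),
      ω ∈ openConnIn {v : Site 3 | v ∈ box 3 L ∧ 0 ≤ σ * v i} x y := by
  rintro ⟨x, hx, y, hy, hxF, hyF, hreach⟩
  apply hb
  refine ⟨x, hx, y, hy, ?_⟩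
  have hFT : {v : Site 3 | v ∈ box 3 L ∧ 0 ≤ σ * v i} ⊆ (↑(box 3 L) : Set (Site 3)) :=
    fun v hv => Finset.mem_coe.2 hv.1
  let φ : ((openGraph ω).induce {v : Site 3 | v ∈ box 3 L ∧ 0 ≤ σ * v i}) →g
      ((openGraph (ω \ ↑S)).induce (↑(box 3 L) : Set (Site 3))) :=
    { toFun := fun v => ⟨v.1, hFT v.2⟩
      map_rel' := by
        intro a b hab
        simp only [SimpleGraph.induce_adj, openGraph_adj, Set.mem_sdiff, Finset.mem_coe] at hab ⊢
        refine ⟨⟨hab.1, fun hS => ?_⟩, hab.2⟩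
        obtain ⟨v, hv, hvσ⟩ := hpol _ hS
        have ha := a.2.2
        have hb := b.2.2
        rcases Sym2.mem_iff.1 hv with rfl | rfl
        · linarith
        · linarith }
  exact ⟨hFT hxF, hFT hyF, hreach.map φ⟩

/-- An edge of `ℤ³` has an endpoint with a nonzero coordinate in the direction of the edge: if
`u ∼ w` then `w = u ± eᵢ` for some `i`, so `u_i` and `w_i` cannot both vanish. -/
theorem exists_mem_apply_ne_zero {u w : Site 3} (h : (zdGraph 3).Adj u w) :
    ∃ v ∈ s(u, w), ∃ i : Fin 3, v i ≠ 0 := by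
  obtain ⟨i, hi | hi⟩ := (zdGraph_adj_iff u w).1 h
  · by_cases hu : u i = 0
    · refine ⟨w, Sym2.mem_mk_right u w, i, ?_⟩
      rw [hi]
      simp [hu]
    · exact ⟨u, Sym2.mem_mk_left u w, i, hu⟩
  · by_cases hw : w i = 0
    · refine ⟨u, Sym2.mem_mk_left u w, i, ?_⟩
      rw [hi]
      simp [hw]
    · exact ⟨w, Sym2.mem_mk_right u w, i, hw⟩

/-- **Pointwise inclusion** (lattice configurations): if the annulus `box 3 n → ∂ⁱⁿ box 3 L` is blocked
inside `box 3 L` by closing at most one edge, then for some signed axis `(i, σ)`, `σ = ±1`, the closed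
front half-box `{v ∈ box 3 L | σ v_i ≥ 0}` carries no open path from `box 3 n` to `∂ⁱⁿ box 3 L`
(the half-box events are written in the translated shape of the stub, with centre `0`). -/
theorem mem_iUnion_front_of_blocked {n L : ℕ} {ω : BondConfig (Site 3)}
    (hω : ω ⊆ (zdGraph 3).edgeSet)
    (h : ω ∈ {ω : BondConfig (Site 3) | ∃ S : Finset (Sym2 (Site 3)), S.card ≤ 1 ∧
      ¬ ∃ x ∈ box 3 n, ∃ y ∈ innerBoundary (zdGraph 3) (box 3 L),
        (ω \ (↑S : Set (Sym2 (Site 3)))) ∈ openConnIn (↑(box 3 L) : Set (Site 3)) x y}) :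
    ω ∈ ⋃ ax ∈ (Finset.univ : Finset (Fin 3)) ×ˢ ({1, -1} : Finset ℤ),
      {ω : BondConfig (Site 3) | ¬ ∃ x ∈ (box 3 n).image (· + (0 : Site 3)),
        ∃ y ∈ (innerBoundary (zdGraph 3) (box 3 L)).image (· + (0 : Site 3)),
          ω ∈ openConnIn {v : Site 3 | v - (0 : Site 3) ∈ box 3 L ∧
            0 ≤ ax.2 * (v ax.1 - (0 : Site 3) ax.1)} x y} := by
  suffices H : ∃ i : Fin 3, ∃ σ : ℤ, (σ = 1 ∨ σ = -1) ∧
      ¬ ∃ x ∈ box 3 n, ∃ y ∈ innerBoundary (zdGraph 3) (box 3 L),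
        ω ∈ openConnIn {v : Site 3 | v ∈ box 3 L ∧ 0 ≤ σ * v i} x y by
    obtain ⟨i, σ, hσ, hF⟩ := H
    refine Set.mem_iUnion₂.2 ⟨(i, σ), ?_, ?_⟩
    · simpa using hσ
    · simpa only [Set.mem_setOf_eq, add_zero, Finset.image_id', sub_zero, Pi.zero_apply] using hF
  obtain ⟨S, hSE, hS, hb⟩ := exists_cutset_subset_edgesIn hω h
  rcases S.eq_empty_or_nonempty with rfl | ⟨e, he⟩
  · exact ⟨0, 1, Or.inl rfl, front_blocked_of_polar (S := ∅) (by simp) hb⟩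
  · have hall : ∀ e' ∈ S, e' = e := fun e' he' => Finset.card_le_one.1 hS e' he' e he
    have heE : e ∈ (zdGraph 3).edgeSet := (mem_edgesIn_iff.1 (hSE he)).1
    clear he hSE
    induction e using Sym2.ind with
    | h u w =>
      obtain ⟨v, hv, i, hvi⟩ := exists_mem_apply_ne_zero ((SimpleGraph.mem_edgeSet _).1 heE)
      rcases lt_or_gt_of_ne hvi with hlt | hgt
      · exact ⟨i, 1, Or.inl rfl, front_blocked_of_polar (S := S)
          (fun e' he' => ⟨v, (hall e' he') ▸ hv, by linarith⟩) hb⟩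
      · exact ⟨i, -1, Or.inr rfl, front_blocked_of_polar (S := S)
          (fun e' he' => ⟨v, (hall e' he') ▸ hv, by linarith⟩) hb⟩

end StubPinholeBehindPlane

/-- **A single pinhole lies behind a coordinate plane** (`k = 0` covering of the line
`halfspace-polarisation`).  For critical bond percolation on `ℤ³`:
`P(box 3 n → ∂ⁱⁿ box 3 L is blocked inside box 3 L after closing ≤ 1 edge)
  ≤ Σ_{(i,σ) ∈ Fin 3 × {±1}} P(no open path box 3 n → ∂ⁱⁿ box 3 L inside {v ∈ box 3 L | σ v_i ≥ 0})`.
Proof: a.s. the configuration is a lattice configuration (`real_mono_of_lattice`); for those the blocked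
event is contained in the union of the six half-box events
(`StubPinholeBehindPlane.mem_iUnion_front_of_blocked`: the blocking edge, taken inside the box by
`exists_cutset_subset_edgesIn`, has an endpoint strictly behind some coordinate plane, and back-polarised
closures do not affect front-confined paths); conclude with the union bound `measureReal_biUnion_finset_le`. -/
theorem stub_pinholeBehindPlane :
    ∀ (n L : ℕ), (bondPercolation (zdGraph 3) (criticalProbI 3)).real
        {ω : BondConfig (Site 3) | ∃ S : Finset (Sym2 (Site 3)), S.card ≤ 1 ∧ ¬ ∃ x ∈ box 3 n, ∃ y ∈ innerBoundary (zdGraph 3) (box 3 L), (ω \ (↑S : Set (Sym2 (Site 3)))) ∈ openConnIn (↑(box 3 L) : Set (Site 3)) x y} ≤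
      ∑ ax ∈ (Finset.univ : Finset (Fin 3)) ×ˢ ({1, -1} : Finset ℤ), (bondPercolation (zdGraph 3) (criticalProbI 3)).real
        {ω : BondConfig (Site 3) | ¬ ∃ x ∈ (box 3 n).image (· + (0 : Site 3)), ∃ y ∈ (innerBoundary (zdGraph 3) (box 3 L)).image (· + (0 : Site 3)), ω ∈ openConnIn {v : Site 3 | v - (0 : Site 3) ∈ box 3 L ∧ 0 ≤ ax.2 * (v ax.1 - (0 : Site 3) ax.1)} x y} := by
  intro n L
  calc (bondPercolation (zdGraph 3) (criticalProbI 3)).real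
        {ω : BondConfig (Site 3) | ∃ S : Finset (Sym2 (Site 3)), S.card ≤ 1 ∧ ¬ ∃ x ∈ box 3 n,
          ∃ y ∈ innerBoundary (zdGraph 3) (box 3 L),
            (ω \ (↑S : Set (Sym2 (Site 3)))) ∈ openConnIn (↑(box 3 L) : Set (Site 3)) x y}
      ≤ (bondPercolation (zdGraph 3) (criticalProbI 3)).real
          (⋃ ax ∈ (Finset.univ : Finset (Fin 3)) ×ˢ ({1, -1} : Finset ℤ),
            {ω : BondConfig (Site 3) | ¬ ∃ x ∈ (box 3 n).image (· + (0 : Site 3)),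
              ∃ y ∈ (innerBoundary (zdGraph 3) (box 3 L)).image (· + (0 : Site 3)),
                ω ∈ openConnIn {v : Site 3 | v - (0 : Site 3) ∈ box 3 L ∧
                  0 ≤ ax.2 * (v ax.1 - (0 : Site 3) ax.1)} x y}) :=
        real_mono_of_lattice fun ω hω h =>
          StubPinholeBehindPlane.mem_iUnion_front_of_blocked hω h
    _ ≤ _ := measureReal_biUnion_finset_le _ _

end Summit.CriticalPhenomena.PercolationContinuityZ3.Theorems

end
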